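/- Width seat `ym-line-cbag-p1-w2` (prover-ym-line-cbag-p1-w2-g0-0), route `ColdBoxAllGroups`, crux `BoxFloorAllGroups`
(stmt-QuantumFields-22254), line `birth`, lead PLAN v5: brick B5 in the EXACT-JACOBIAN form «ChartDensityJ» (alternative to the lead's
soft-sandwich B5 «ChartDensityG»), toward the load-bearing stub S2 `stub_boxDirichletDominationAbsG`. -/
import Summits.QuantumFields.YangMills.Theorems.ColdBoxAllGroupsExpChartPackage2Haar
import Summits.QuantumFields.YangMills.Theorems.EquipartitionCriticalityFreeEnergyLogCoefficientExpChartMeasure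
import Literature.NumberTheory.Automorphic.LocalWeylLaw

/-!
# Crux `BoxFloorAllGroups`, stub S2, brick B5-J «ChartDensityJ»: the chart measure on small balls IS `c_H · J · Lebesgue` with the
# exact, continuous Helgason Jacobian `J = 1 + O(|a|²)`

For a compact group `G` with a faithful continuous unitary representation `ρ : G →* U(N)` and the tree's exponential chart
`ψ = expChart ρ : ℝ^D → G` (`D = dimE ρ`), the pull-back `chartMeasureE ρ (1/4)` of the Haar probability measure along `ψ|_{b(0,1/4)}`
(`FreeEnergyLogCoefficient.chartMeasureE`, the currency of the one-scale expansion's product-chart formulas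
`haar_restrict_image_expChart` / `lintegral_pi_image_expChart`) satisfies, on every small closed ball,
`(chartMeasureE ρ (1/4))|_{b(0,r)} = (c_H · vol|_{b(0,r)}) · J` with ONE constant `c_H > 0`, a continuous (hence measurable) density
`J : ℝ^D → ℝ`, `|J(a) − 1| ≤ C₂‖a‖²` and `½ ≤ J(a) ≤ 3/2` for `‖a‖ ≤ r₂` (`0 < r ≤ r₂ ≤ 1/16`):
* **`exists_chartMeasureE_restrict_closedBall_eq_withDensity`** — the measure identity (the lead's B5 shape with `g := J`; the density
  constant is Helgason's `σ₀`, not the soft `haarConstE ρ` — immaterial for the normalised tilted measures of B4/B9);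
* `abs_log_jacobian_le` — the per-link tilt constant of the exact route: `|log J(a)| ≤ 2·C₂·‖a‖²` for `‖a‖ ≤ r₂`
  (so `ℓ = 2·C₂·m²` in the lead's `abs_tiltWE_le`, route «ℓ ≍ m²» of its header; the scalar step `|log y| ≤ 2|y − 1|` is the tree's
  `Literature.NumberTheory.Automorphic.abs_log_le_two_mul`).
Source of the mathematics: the landed `ExpChart2.exists_haar_expChart_eq` (Helgason, *Groups and Geometric Analysis* Ch. I Thm. 1.14 in
the route's chart coordinates, via the Literature's `IsChartRep` engine), `chartMeasureE_apply`, the Lusin–Souslin measurable embedding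
`measurableEmbedding_restrict_expChart` and the injectivity of the chart on `b(0,1/4)`.
No sorry; no definition; standard axioms.  NOT a claim about the Yang–Mills mass gap (rung-level support, RECORD label).
-/

set_option autoImplicit false

noncomputable section

open scoped ENNReal
open MeasureTheory Set Metric
open Literature.MathematicalPhysics.QuantumFieldTheory

namespace Summit.QuantumFields.YangMills.Theorems.ColdBoxAllGroups

open Summit.QuantumFields.YangMills.Theorems.FreeEnergyLogCoefficient (dimE expChart chartMeasureE chartMeasureE_apply
  injOn_expChart measurableEmbedding_restrict_expChart)

variable {N : ℕ} {G : Type} [Group G] [TopologicalSpace G] [IsTopologicalGroup G] [CompactSpace G] [MeasurableSpace G] [BorelSpace G]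
  (ρ : G →* Matrix (Fin N) (Fin N) ℂ)

/-- **B5-J — the chart measure on small balls is `c_H · J · Lebesgue` with the exact Jacobian.**  For a faithful continuous unitary
`ρ : G →* U(N)` there are `0 < r₂ ≤ 1/16`, `C₂ > 0`, `c_H > 0` and a continuous `J : ℝ^D → ℝ` with `|J a − 1| ≤ C₂‖a‖²` and
`½ ≤ J a ≤ 3/2` for `‖a‖ ≤ r₂`, such that for every `0 < r ≤ r₂`
`(chartMeasureE ρ (1/4)).restrict (closedBall 0 r) = ((ENNReal.ofReal c_H) • volume.restrict (closedBall 0 r)).withDensity (ofReal ∘ J)`.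
[cite: Helgason2000, Ch. I §1 Thm. 1.14 p. 96] -/
theorem exists_chartMeasureE_restrict_closedBall_eq_withDensity (hρ : Continuous ρ) (hinj : Function.Injective ρ)
    (hU : ∀ g, ρ g ∈ Matrix.unitaryGroup (Fin N) ℂ) :
    ∃ (r₂ C₂ cH : ℝ), 0 < r₂ ∧ r₂ ≤ 1 / 16 ∧ 0 < C₂ ∧ 0 < cH ∧
      ∃ J : EuclideanSpace ℝ (Fin (dimE ρ)) → ℝ, Continuous J ∧
        (∀ a, ‖a‖ ≤ r₂ → |J a - 1| ≤ C₂ * ‖a‖ ^ 2) ∧ (∀ a, ‖a‖ ≤ r₂ → 1 / 2 ≤ J a ∧ J a ≤ 3 / 2) ∧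
        ∀ r : ℝ, 0 < r → r ≤ r₂ →
          (chartMeasureE ρ (1 / 4)).restrict (closedBall 0 r) =
            ((ENNReal.ofReal cH) • (volume.restrict (closedBall (0 : EuclideanSpace ℝ (Fin (dimE ρ))) r))).withDensity
              fun a => ENNReal.ofReal (J a) := by
  obtain ⟨r₀, C₂, cH, hr₀, hC₂, hcH, J, hJc, hJb, hint⟩ :=
    ExpChart2.exists_haar_expChart_eq (G := G) (⟨N, ρ, hρ, hinj, hU⟩ : LatticeRep G)
  -- shrink the radius so that `J ∈ [1/2, 3/2]` and `r₂ ≤ 1/16`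
  set r₂ : ℝ := min r₀ (min (1 / 16) (1 / (2 * C₂ + 2))) with hr₂def
  have hr₂0 : 0 < r₂ := lt_min hr₀ (lt_min (by norm_num) (by positivity))
  have hr₂r₀ : r₂ ≤ r₀ := min_le_left _ _
  have hr₂16 : r₂ ≤ 1 / 16 := (min_le_right _ _).trans (min_le_left _ _)
  have hr₂C : r₂ ≤ 1 / (2 * C₂ + 2) := (min_le_right _ _).trans (min_le_right _ _)
  have hJb' : ∀ a : EuclideanSpace ℝ (Fin (dimE ρ)), ‖a‖ ≤ r₂ → |J a - 1| ≤ C₂ * ‖a‖ ^ 2 :=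
    fun a ha => hJb a (ha.trans hr₂r₀)
  have hJhalf : ∀ a : EuclideanSpace ℝ (Fin (dimE ρ)), ‖a‖ ≤ r₂ → |J a - 1| ≤ 1 / 2 := by
    intro a ha
    refine (hJb' a ha).trans ?_
    have h1 : ‖a‖ ≤ 1 := ha.trans (hr₂16.trans (by norm_num))
    have h2 : ‖a‖ ^ 2 ≤ ‖a‖ := by nlinarith [norm_nonneg a]
    have h3 : C₂ * ‖a‖ ≤ C₂ * (1 / (2 * C₂ + 2)) := mul_le_mul_of_nonneg_left (ha.trans hr₂C) hC₂.le
    have h4 : C₂ * (1 / (2 * C₂ + 2)) ≤ 1 / 2 := by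
      rw [mul_one_div, div_le_iff₀ (by positivity)]; linarith
    nlinarith
  refine ⟨r₂, C₂, cH, hr₂0, hr₂16, hC₂, hcH, J, hJc, hJb', fun a ha => ?_, fun r hr hrr => ?_⟩
  · have h := abs_le.1 (hJhalf a ha)
    constructor <;> linarith [h.1, h.2]
  · -- the measure identity, set by set
    have hr4 : closedBall (0 : EuclideanSpace ℝ (Fin (dimE ρ))) r ⊆ closedBall 0 (1 / 4) :=
      closedBall_subset_closedBall (hrr.trans (hr₂16.trans (by norm_num)))
    have hJm : Measurable fun a : EuclideanSpace ℝ (Fin (dimE ρ)) => ENNReal.ofReal (J a) := hJc.measurable.ennreal_ofReal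
    ext s hs
    -- the image `T = ψ(s ∩ b(0,r))` is measurable (Lusin–Souslin through the measurable embedding `ψ|_{b(0,1/4)}`)
    set T : Set G := expChart ρ '' (s ∩ closedBall 0 r) with hTdef
    have hTmeas : MeasurableSet T := by
      have h1 : T = (Set.restrict (closedBall (0 : EuclideanSpace ℝ (Fin (dimE ρ))) (1 / 4)) (expChart ρ)) ''
          (Subtype.val ⁻¹' (s ∩ closedBall 0 r)) := by
        rw [Set.restrict_eq, Set.image_comp, Subtype.image_preimage_coe, Set.inter_eq_right.2
          ((Set.inter_subset_right).trans hr4)]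
      rw [h1]
      exact (measurableEmbedding_restrict_expChart ρ hρ hinj).measurableSet_image'
        (measurable_subtype_coe (hs.inter measurableSet_closedBall))
    have hTsub : T ⊆ expChart ρ '' closedBall 0 r := Set.image_mono Set.inter_subset_right
    -- left-hand side: `ν(s ∩ b(0,r)) = σ(T)`
    have hL : (chartMeasureE ρ (1 / 4)).restrict (closedBall 0 r) s = haarProbability G T := by
      rw [Measure.restrict_apply hs, chartMeasureE_apply ρ hρ hinj, Set.inter_assoc, Set.inter_eq_left.2 hr4]
    -- Helgason's identity for `F = 𝟙_T`
    have hF : Measurable (T.indicator (1 : G → ℝ≥0∞)) := measurable_one.indicator hTmeas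
    have key := hint r hr (hrr.trans hr₂r₀) _ hF
    have hleft : ∫⁻ g in expChart ρ '' closedBall 0 r, T.indicator (1 : G → ℝ≥0∞) g ∂(haarProbability G) =
        haarProbability G T := by
      rw [lintegral_indicator_one hTmeas, Measure.restrict_apply hTmeas, Set.inter_eq_left.2 hTsub]
    have hright : ∫⁻ a in closedBall (0 : EuclideanSpace ℝ (Fin (dimE ρ))) r,
        T.indicator (1 : G → ℝ≥0∞) (expChart ρ a) * ENNReal.ofReal (J a) =
          ∫⁻ a in s ∩ closedBall 0 r, ENNReal.ofReal (J a) := by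
      have hpt : ∀ a ∈ closedBall (0 : EuclideanSpace ℝ (Fin (dimE ρ))) r,
          T.indicator (1 : G → ℝ≥0∞) (expChart ρ a) * ENNReal.ofReal (J a) =
            s.indicator (fun a => ENNReal.ofReal (J a)) a := by
        intro a ha
        by_cases has : a ∈ s
        · rw [Set.indicator_of_mem (Set.mem_image_of_mem (expChart ρ) (Set.mem_inter has ha)), Set.indicator_of_mem has,
            Pi.one_apply, one_mul]
        · rw [Set.indicator_of_notMem has, Set.indicator_of_notMem, zero_mul]
          rintro ⟨a', ⟨ha's, ha'r⟩, hEq⟩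
          have : a' = a := injOn_expChart ρ hρ (hr4 ha'r) (hr4 ha) hEq
          exact has (this ▸ ha's)
      rw [setLIntegral_congr_fun measurableSet_closedBall hpt, lintegral_indicator hs,
        Measure.restrict_restrict hs]
    rw [hleft, hright] at key
    -- right-hand side
    have hR : (((ENNReal.ofReal cH) • (volume.restrict (closedBall (0 : EuclideanSpace ℝ (Fin (dimE ρ))) r))).withDensity
        fun a => ENNReal.ofReal (J a)) s = ENNReal.ofReal cH * ∫⁻ a in s ∩ closedBall 0 r, ENNReal.ofReal (J a) := by
      rw [withDensity_apply _ hs, Measure.restrict_smul, lintegral_smul_measure, Measure.restrict_restrict hs, smul_eq_mul]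
    rw [hL, hR, key]

/-- **The per-link tilt constant of the exact route**: with `J` as above, `|log J(a)| ≤ 2·C₂·‖a‖²` for `‖a‖ ≤ r₂`
(`|J − 1| ≤ C₂‖a‖² ≤ ½` there). -/
theorem abs_log_jacobian_le {D : ℕ} {J : EuclideanSpace ℝ (Fin D) → ℝ} {C₂ r₂ : ℝ}
    (hJb : ∀ a, ‖a‖ ≤ r₂ → |J a - 1| ≤ C₂ * ‖a‖ ^ 2) (hJhalf : ∀ a, ‖a‖ ≤ r₂ → 1 / 2 ≤ J a ∧ J a ≤ 3 / 2)
    (a : EuclideanSpace ℝ (Fin D)) (ha : ‖a‖ ≤ r₂) : |Real.log (J a)| ≤ 2 * C₂ * ‖a‖ ^ 2 := by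
  have h1 : |J a - 1| ≤ 1 / 2 := abs_le.2 ⟨by linarith [(hJhalf a ha).1], by linarith [(hJhalf a ha).2]⟩
  calc |Real.log (J a)| ≤ 2 * |J a - 1| := Literature.NumberTheory.Automorphic.abs_log_le_two_mul h1
    _ ≤ 2 * (C₂ * ‖a‖ ^ 2) := by gcongr; exact hJb a ha
    _ = 2 * C₂ * ‖a‖ ^ 2 := by ring

end Summit.QuantumFields.YangMills.Theorems.ColdBoxAllGroups

end
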